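import Summits.NavierStokesRegularity.NavierStokesRegularity.Theorems.SqueezeCycleSingularZoomReduction
import Summits.NavierStokesRegularity.NavierStokesRegularity.Theorems.SqueezeCycleSingularZoomExtraction
import Summits.NavierStokesRegularity.NavierStokesRegularity.Theorems.SqueezeCycleSingularZoomEnergy
import Summits.NavierStokesRegularity.NavierStokesRegularity.Theorems.SqueezeCycleSingularZoomSingular
import Summits.NavierStokesRegularity.NavierStokesRegularity.Theorems.SqueezeCycleExtremalElementExistsRescale
import Summits.NavierStokesRegularity.NavierStokesRegularity.Theses.SqueezeCycle
import Summits.NavierStokesRegularity.NavierStokesRegularity.Theses.ClockStretchingLaw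
import HarnessLib

/-!
# Route `SqueezeCycle` (and `ClockStretchingLaw`), support item `SingularZoom`
# (stmt-NavierStokesRegularity-10573): the singular Type-I zoom limit, and the item

`SingularZoom`: if no element of the Type-I model class `𝒦_C` — smooth divergence-free KNSS-mild
ancient fields with the Type-I rate `‖u‖ ≤ C/√(−t)` and scale-invariant local energies `A, E ≤ C`
on all backward cylinders with vertex time `≤ 0` — is unbounded at the space–time origin, then a
finite-energy classical solution on `[0, T)` from a rapidly decaying datum with the Type-I rate near
`T` extends smoothly past `T`.

The tree's `singularZoom_of_zoomLimit` (`SqueezeCycleSingularZoomReduction.lean`) reduces the item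
to the **singular Type-I zoom limit** `singularZoom_zoomLimit` proved here (Albritton–Barker 2019,
§3, forward direction WITHOUT sup-normalisation; Koch–Nadirashvili–Seregin–Šverák 2009, Lemma 6.1
and Prop. 4.1; Rusin–Šverák 2011): at a backward singular final-time point `(T, x₀)` of a classical
Leray–Hopf solution with the Type-I rate, the viscosity-normalising zooms
`w_k(s, y) = c_kα u(T + c_k²β s, x₀ + c_kR y)`, `c_k ↓ 0`, keep the rate (`zoom_norm_le`), are
Oseen-mild classical solutions on growing final windows (`zoom_oseen`), converge in `C¹_loc(t < 0)`
along a subsequence to a Type-I ancient mild field `W` (`exists_tendsto_of_typeI_seq_Ioo`), inherit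
the scale-invariant energies from the Morrey bound and the local Type-I quantity of the unit zoom
(`morrey_of_typeI`, `exists_zoom_typeIBound_lt_top_of_morrey`, `energyBounds_of_tendsto_Ioo`), and
`W` is unbounded at the origin by compactness and persistence of singularities
(`unbounded_at_origin_of_zoomIn_limit`). Main results: `singularZoom_zoomLimit`,
`singularZoom_proof : SqueezeCycle.SingularZoom`, `clockStretchingLaw_singularZoom_proof`.
-/

noncomputable section

open MeasureTheory Set Function Filter TopologicalSpace Metric
open scoped Topology NNReal ENNReal InnerProductSpace RealInnerProductSpace

namespace Summit.NavierStokesRegularity.NavierStokesRegularity.Theorems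

open Literature.Analysis Literature.Analysis.FluidPDE

/-- The image of `Q(z, r)`, `z = (t₀, x₁)`, `t₀ ≤ 0`, under the zoom about the origin with a small
factor `c` lies in `Q(0, 1/2)`: it suffices that `c²(r² − t₀) ≤ 1/4` and `c(‖x₁‖ + r) ≤ 1/2`.
[folklore] -/
theorem parabolicCylinder_zoomIn_subset_half {c t₀ r : ℝ} {x₁ : EuclideanSpace ℝ (Fin 3)}
    (hc : 0 < c) (ht₀ : t₀ ≤ 0) (h1 : c ^ 2 * (r ^ 2 - t₀) ≤ 1 / 4) (h2 : c * (‖x₁‖ + r) ≤ 1 / 2) :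
    parabolicCylinder (c * r) (stAffine (c ^ 2) c 0 0 ((t₀, x₁) : ℝ × EuclideanSpace ℝ (Fin 3))) ⊆
      parabolicCylinder (1 / 2) (0 : ℝ × EuclideanSpace ℝ (Fin 3)) := by
  intro w hw
  rw [mem_parabolicCylinder] at hw
  simp only [stAffine_apply, zero_add] at hw
  obtain ⟨⟨hw1, hw2⟩, hw3⟩ := hw
  rw [SuitableCompactness.mem_parabolicCylinder_zero]
  have hct : c ^ 2 * t₀ ≤ 0 := mul_nonpos_of_nonneg_of_nonpos (sq_nonneg c) ht₀
  have e1 : (c * r) ^ 2 = c ^ 2 * r ^ 2 := by ring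
  have e2 : c ^ 2 * (r ^ 2 - t₀) = c ^ 2 * r ^ 2 - c ^ 2 * t₀ := by ring
  have e3 : c * (‖x₁‖ + r) = c * ‖x₁‖ + c * r := by ring
  refine ⟨⟨by linarith, hw2.trans_le hct⟩, ?_⟩
  have hx : ‖w.2‖ ≤ dist w.2 (c • x₁) + c * ‖x₁‖ := by
    have h := norm_le_norm_add_norm_sub' w.2 (c • x₁)
    rw [norm_smul, Real.norm_eq_abs, abs_of_pos hc, ← dist_eq_norm] at h
    linarith
  linarith

section ZoomSeq

variable {ν T : ℝ} {u : ℝ → EuclideanSpace ℝ (Fin 3) → EuclideanSpace ℝ (Fin 3)}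
  {p : ℝ → EuclideanSpace ℝ (Fin 3) → ℝ} {x₀ : EuclideanSpace ℝ (Fin 3)} {C δ R α β c : ℝ}

/-- **The zoom at scale `c` is the zoom-in by `c` of the unit zoom**:
`(cα) • u ∘ Φ_{c²β, cR} = c • stPull (c²) c 0 0 (α • stPull β R T x₀ u)`. [folklore] -/
theorem zoom_eq_zoomIn (T : ℝ) (x₀ : EuclideanSpace ℝ (Fin 3))
    (u : ℝ → EuclideanSpace ℝ (Fin 3) → EuclideanSpace ℝ (Fin 3)) (α β R c : ℝ) :
    (c * α) • stPull (c ^ 2 * β) (c * R) T x₀ u = c • stPull (c ^ 2) c 0 0 (α • stPull β R T x₀ u) := by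
  funext s y
  simp only [smul_stPull_apply, zero_add, smul_smul]
  rw [show β * (c ^ 2 * s) = c ^ 2 * β * s by ring, show R * c = c * R by ring]

/-- **The zoomed gradient is the gradient of the zoom**: on the final window of the scale `c`,
`c² ((αR) ∇u ∘ Φ) ∘ Φ_c = ∇(c • stPull (c²) c 0 0 (α • stPull β R T x₀ u))` (two chain rules). [folklore] -/
theorem fderiv_zoomIn_eq (hsol : IsClassicalNSSolutionOn (Ico 0 T) ν 0 u p) (hβ : 0 < β)
    (hδT : δ ≤ T) (hc : 0 < c) {t : ℝ} (ht : t ∈ Ioo (-(δ / (c ^ 2 * β))) 0)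
    (y : EuclideanSpace ℝ (Fin 3)) :
    (c ^ 2 • stPull (c ^ 2) c 0 0 ((α * R) • stPull β R T x₀ (fun t x => fderiv ℝ (u t) x))) t y =
      fderiv ℝ ((c • stPull (c ^ 2) c 0 0 (α • stPull β R T x₀ u)) t) y := by
  obtain ⟨-, htI⟩ := zoom_time_mem (T := T) hc hβ hδT ht
  have hdu : Differentiable ℝ (u (T + β * (c ^ 2 * t))) := by
    rw [show T + β * (c ^ 2 * t) = T + c ^ 2 * β * t by ring]
    exact (hsol.contDiff_velocity htI).differentiable (by simp)
  have hvs : (α • stPull β R T x₀ u) (c ^ 2 * t) = fun x => α • stPull β R T x₀ u (c ^ 2 * t) x := rfl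
  have hdv : Differentiable ℝ ((α • stPull β R T x₀ u) (c ^ 2 * t)) := by
    rw [hvs]; exact (differentiable_stPull_slice hdu).const_smul α
  have hfv : ∀ x, fderiv ℝ ((α • stPull β R T x₀ u) (c ^ 2 * t)) x =
      α • (R • fderiv ℝ (u (T + β * (c ^ 2 * t))) (x₀ + R • x)) := by
    intro x
    rw [hvs, fderiv_fun_const_smul ((differentiable_stPull_slice hdu) x), fderiv_stPull]
  rw [fderiv_zoom 0 _ hdv y, hfv]
  show c ^ 2 • ((α * R) • fderiv ℝ (u (T + β * (0 + c ^ 2 * t))) (x₀ + R • (0 + c • y))) =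
    c ^ 2 • (α • (R • fderiv ℝ (u (T + β * (c ^ 2 * t))) (x₀ + R • (0 + c • y))))
  rw [zero_add, smul_smul α R]

/-- **The dissipation of the zooms on small cylinders** (per scale): if `(T, x₀)` carries the unit
zoom with finite local Type-I quantity `I₀ = 𝐈(Q(0,1/2))` and the cylinder `Q((t₀, x₁), r)`,
`t₀ < 0`, lies in the window of the scale `c` with `c²(r² − t₀) ≤ 1/4`, `c(‖x₁‖ + r) ≤ 1/2`, then
`r⁻¹ ∫_{(t₀−r², t₀)} ∫_{B(x₁, r)} ‖∇w_c‖² ≤ I₀.toReal` (`zoomIn_gradEnergy_le`). [cite: AlbrittonBarker2019, §1 and §3] -/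
theorem zoom_gradEnergy_le (hν : 0 < ν) (hsol : IsClassicalNSSolutionOn (Ico 0 T) ν 0 u p)
    (hR : 0 < R) (hα : α = R / ν) (hβ : β = R ^ 2 / ν) (hc : 0 < c) (hδT : δ ≤ T)
    {πv : ℝ → EuclideanSpace ℝ (Fin 3) → ℝ}
    (hI : typeIBound (parabolicCylinder (1 / 2) (0 : ℝ × EuclideanSpace ℝ (Fin 3)))
      (α • stPull β R T x₀ u) πv ((α * R) • stPull β R T x₀ (fun t x => fderiv ℝ (u t) x)) ≠ ∞)
    {t₀ r : ℝ} (ht₀ : t₀ < 0) (hr : 0 < r) (hwin : -(δ / (c ^ 2 * β)) < t₀ - r ^ 2)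
    {x₁ : EuclideanSpace ℝ (Fin 3)} (h1 : c ^ 2 * (r ^ 2 - t₀) ≤ 1 / 4) (h2 : c * (‖x₁‖ + r) ≤ 1 / 2) :
    r⁻¹ * ∫ t in Ioo (t₀ - r ^ 2) t₀, ∫ y in ball x₁ r,
        ‖fderiv ℝ (((c * α) • stPull (c ^ 2 * β) (c * R) T x₀ u) t) y‖ ^ 2 ≤
      (typeIBound (parabolicCylinder (1 / 2) (0 : ℝ × EuclideanSpace ℝ (Fin 3)))
        (α • stPull β R T x₀ u) πv ((α * R) • stPull β R T x₀ (fun t x => fderiv ℝ (u t) x))).toReal := by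
  have hβpos : 0 < β := by rw [hβ]; positivity
  have hz := parabolicCylinder_zoomIn_subset_half (x₁ := x₁) hc ht₀.le h1 h2
  have hcl := zoom_isClassical (x₀ := x₀) hν hsol hR hα hβ hc hδT
  have hD := IsSmoothSpaceTimeOn.continuousOn_fderiv_slice hcl.smooth_velocity isOpen_Ioo.uniqueDiffOn
  rw [zoom_eq_zoomIn] at hD ⊢
  have hsub : Icc (t₀ - r ^ 2) t₀ ⊆ Ioo (-(δ / (c ^ 2 * β))) 0 := fun s hs =>
    ⟨lt_of_lt_of_le hwin hs.1, lt_of_le_of_lt hs.2 ht₀⟩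
  exact zoomIn_gradEnergy_le (π := πv) hc hI isOpen_Ioo hr hsub hD
    (fun t ht y => fderiv_zoomIn_eq hsol hβpos hδT hc (hsub (Ioo_subset_Icc_self ht)) y) hz

/-- **The limit of the zooms along scales `c j ∈ (0, 1/2]` is unbounded at the origin**
(`unbounded_at_origin_of_zoomIn_limit` for the zoom-ins of the unit zoom at a backward singular
final-time point, with the uniform bounds `eLpNorm_zoomIn_velocity_le`, `eLpNorm_zoomIn_pressure_le` and
the essential unboundedness `eLpNorm_top_zoomIn_eq_top`). [cite: AlbrittonBarker2019, Lemma 2.2 and Prop. 2.3] -/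
theorem zoomSeq_unbounded_at_origin (hsol : IsClassicalNSSolutionOn (Ico 0 T) ν 0 u p)
    (hR : 0 < R) (hαpos : 0 < α) (hβpos : 0 < β) (hβT : β ≤ T)
    (hsing : ∀ r : ℝ, 0 < r →
      eLpNorm (uncurry u) ∞ (volume.restrict (parabolicCylinder r ((T : ℝ), x₀))) = ∞)
    {πv : ℝ → EuclideanSpace ℝ (Fin 3) → ℝ}
    (hball : IsSuitableWeakSolutionInBall 1 0 (α • stPull β R T x₀ u) πv)
    (hGv : HasWeakSpatialGradientOn (parabolicCylinderOpens 1 (0 : ℝ × EuclideanSpace ℝ (Fin 3)))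
      (α • stPull β R T x₀ u) ((α * R) • stPull β R T x₀ (fun t x => fderiv ℝ (u t) x)))
    (hI : typeIBound (parabolicCylinder (1 / 2) (0 : ℝ × EuclideanSpace ℝ (Fin 3)))
      (α • stPull β R T x₀ u) πv ((α * R) • stPull β R T x₀ (fun t x => fderiv ℝ (u t) x)) ≠ ∞)
    {c : ℕ → ℝ} (hcpos : ∀ j, 0 < c j) (hc2 : ∀ j, c j ≤ 1 / 2)
    {W : ℝ → EuclideanSpace ℝ (Fin 3) → EuclideanSpace ℝ (Fin 3)}
    (hpt : ∀ z ∈ parabolicCylinder (1 / 2) (0 : ℝ × EuclideanSpace ℝ (Fin 3)),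
      Tendsto (fun j => ((c j * α) • stPull (c j ^ 2 * β) (c j * R) T x₀ u) z.1 z.2) atTop
        (𝓝 (W z.1 z.2))) :
    ∀ r > 0, ∀ M : ℝ, ∃ t ∈ Ioo (-(r ^ 2)) (0 : ℝ),
      ∃ x ∈ ball (0 : EuclideanSpace ℝ (Fin 3)) r, M < ‖W t x‖ := by
  set v : ℝ → EuclideanSpace ℝ (Fin 3) → EuclideanSpace ℝ (Fin 3) := α • stPull β R T x₀ u with hv
  set Gv : ℝ → EuclideanSpace ℝ (Fin 3) → EuclideanSpace ℝ (Fin 3) →L[ℝ] EuclideanSpace ℝ (Fin 3) :=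
    (α * R) • stPull β R T x₀ (fun t x => fderiv ℝ (u t) x) with hGvdef
  refine unbounded_at_origin_of_zoomIn_limit
    (W := fun j => c j • stPull (c j ^ 2) (c j) 0 0 v)
    (P := fun j => fun t x => (c j ^ 2 • stPull (c j ^ 2) (c j) 0 0 πv) t x -
      ⨍ y in ball (0 : EuclideanSpace ℝ (Fin 3)) 1, (c j ^ 2 • stPull (c j ^ 2) (c j) 0 0 πv) t y)
    (fun j => isSuitableWeakSolutionInBall_zoomIn hball hGv hI (hcpos j) (hc2 j))
    ?_ (fun j R' hR' => eLpNorm_top_zoomIn_eq_top hsol hR hαpos hβpos hβT hsing (hcpos j) hR'.1 ?_) ?_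
  · refine lt_of_le_of_lt (iSup_le fun j => add_le_add
      (eLpNorm_zoomIn_velocity_le (hcpos j) (hc2 j) πv Gv)
      (eLpNorm_zoomIn_pressure_le (hcpos j) (hc2 j) v Gv)) ?_
    exact ENNReal.add_lt_top.2 ⟨ENNReal.rpow_lt_top_of_nonneg (by norm_num) hI,
      ENNReal.rpow_lt_top_of_nonneg (by norm_num) hI⟩
  · nlinarith [hcpos j, hc2 j, hR'.1, hR'.2]
  · intro z hz
    have h := hpt z hz
    rw [show (fun j => ((c j * α) • stPull (c j ^ 2 * β) (c j * R) T x₀ u) z.1 z.2) =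
        fun j => (c j • stPull (c j ^ 2) (c j) 0 0 v) z.1 z.2 from
      funext fun j => by rw [zoom_eq_zoomIn]] at h
    exact h

end ZoomSeq

/-- **The singular Type-I zoom limit** (Albritton–Barker 2019, §3, forward direction without
sup-normalisation; KNSS 2009, Lemma 6.1 and Prop. 4.1; Rusin–Šverák 2011, Lemmas 2.1–2.2). For
`ν > 0`, `T > 0`, a classical solution `(u, p)` on `ℝ³ × [0, T)`, Leray–Hopf from a rapidly decaying
datum, with `IsTypeIBlowup u T`, and a point `x₀` such that `u` is essentially unbounded on every
backward cylinder `Q_r(T, x₀)`, there are `C` and a Type-I KNSS-mild ancient field `ū`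
(`IsTypeIAncientMild C ū`) with scaled energies `A, E ≤ C` on all backward cylinders with vertex
time `≤ 0` which is unbounded at the origin — exactly the hypothesis `hZL` of the tree's
`singularZoom_of_zoomLimit`. [cite: AlbrittonBarker2019, §3 and Prop. 2.3; KochNadirashviliSereginSverak2009, Lemma 6.1 (arXiv p. 11)] -/
theorem singularZoom_zoomLimit : ∀ (ν T : ℝ), 0 < ν → 0 < T →
      ∀ (u : ℝ → EuclideanSpace ℝ (Fin 3) → EuclideanSpace ℝ (Fin 3))
        (p : ℝ → EuclideanSpace ℝ (Fin 3) → ℝ),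
        IsClassicalNSSolutionOn (Ico 0 T) ν 0 u p → IsLerayHopfOn T ν 0 (u 0) u →
        HasRapidSpatialDecay (u 0) → IsTypeIBlowup u T →
        ∀ x₀ : EuclideanSpace ℝ (Fin 3),
          (∀ r : ℝ, 0 < r →
            eLpNorm (uncurry u) ∞ (volume.restrict (parabolicCylinder r ((T : ℝ), x₀))) = ∞) →
          ∃ (C : ℝ) (ū : ℝ → EuclideanSpace ℝ (Fin 3) → EuclideanSpace ℝ (Fin 3)),
            IsTypeIAncientMild C ū ∧
            (∀ (x₁ : EuclideanSpace ℝ (Fin 3)) (t₀ r : ℝ), t₀ ≤ 0 → 0 < r →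
              (∀ t, t₀ - r ^ 2 < t → t < t₀ → r⁻¹ * ∫ x in ball x₁ r, ‖ū t x‖ ^ 2 ≤ C) ∧
              r⁻¹ * ∫ t in Ioo (t₀ - r ^ 2) t₀, ∫ x in ball x₁ r, ‖fderiv ℝ (ū t) x‖ ^ 2 ≤ C) ∧
            (∀ r > 0, ∀ M : ℝ, ∃ t ∈ Ioo (-(r ^ 2)) (0 : ℝ),
              ∃ x ∈ ball (0 : EuclideanSpace ℝ (Fin 3)) r, M < ‖ū t x‖) := by
  intro ν T hν hT u p hsol hLH hdec hTI x₀ hsing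
  -- ## (1) the Type-I rate window, the Morrey bound and the unit zoom at `(T, x₀)`
  obtain ⟨C, δ, -, hδ, hδT, hrate⟩ := exists_typeI_rate_window hT hTI
  obtain ⟨r₀, M₀, T₁, hr₀, hT₁, hMor⟩ := morrey_of_typeI hν hT hsol hLH hTI
  obtain ⟨R, α, β, hR, hα, hβ, hβeq, hαeq, hβT, hball, hGv, htypeI⟩ :=
    exists_zoom_typeIBound_lt_top_of_morrey hν hT hsol hLH hr₀ hT₁ hMor x₀
  set v : ℝ → EuclideanSpace ℝ (Fin 3) → EuclideanSpace ℝ (Fin 3) := α • stPull β R T x₀ u with hv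
  set πv : ℝ → EuclideanSpace ℝ (Fin 3) → ℝ :=
    α ^ 2 • stPull β R T x₀ (fun t x => p t x - (p t 0 - normalisedPressure (u t) 0)) with hπv
  set Gv : ℝ → EuclideanSpace ℝ (Fin 3) → EuclideanSpace ℝ (Fin 3) →L[ℝ] EuclideanSpace ℝ (Fin 3) :=
    (α * R) • stPull β R T x₀ (fun t x => fderiv ℝ (u t) x) with hGvdef
  set I₀ : ℝ≥0∞ := typeIBound (parabolicCylinder (1 / 2) (0 : ℝ × EuclideanSpace ℝ (Fin 3))) v πv Gv
    with hI₀
  have hI₀top : I₀ ≠ ⊤ := htypeI.ne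
  -- ## (2) the scales `c k = 1/(k+4) ↓ 0` and the zoom sequence
  set c : ℕ → ℝ := fun k => 1 / ((k : ℝ) + 4) with hc
  have hcpos : ∀ k, 0 < c k := fun k => by simp only [hc]; positivity
  have hc4 : ∀ k, c k ≤ 1 / 4 := fun k =>
    div_le_div_of_nonneg_left zero_le_one (by norm_num) (by linarith [(Nat.cast_nonneg k : (0 : ℝ) ≤ k)])
  have hc2 : ∀ k, c k ≤ 1 / 2 := fun k => (hc4 k).trans (by norm_num)
  have hclim : Tendsto c atTop (𝓝 0) :=
    tendsto_const_nhds.div_atTop (tendsto_atTop_add_const_right _ _ tendsto_natCast_atTop_atTop)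
  set w : ℕ → ℝ → EuclideanSpace ℝ (Fin 3) → EuclideanSpace ℝ (Fin 3) :=
    fun k => (c k * α) • stPull (c k ^ 2 * β) (c k * R) T x₀ u with hw
  -- the final windows `(A k, 0)`, `A k → -∞`
  set A : ℕ → ℝ := fun k => -(δ / (c k ^ 2 * β)) with hA
  have hAk : ∀ k, A k = -(δ / β * ((k : ℝ) + 4) ^ 2) := by
    intro k
    simp only [hA, hc]
    field_simp
  have hAlim : Tendsto A atTop atBot := by
    have h1 : Tendsto (fun k : ℕ => ((k : ℝ) + 4) ^ 2) atTop atTop :=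
      (tendsto_pow_atTop two_ne_zero).comp
        (tendsto_atTop_add_const_right _ _ tendsto_natCast_atTop_atTop)
    have h2 : Tendsto (fun k : ℕ => δ / β * ((k : ℝ) + 4) ^ 2) atTop atTop :=
      h1.const_mul_atTop (by positivity)
    refine (tendsto_neg_atTop_atBot.comp h2).congr fun k => ?_
    rw [hAk k]
    rfl
  -- ## (3) per-scale facts
  have hcW : ∀ k, ContinuousOn (uncurry (w k)) (Ioo (A k) 0 ×ˢ univ) := fun k =>
    zoom_continuousOn hν hsol hR hαeq hβeq (hcpos k) hδT
  have hdivW : ∀ k, ∀ t ∈ Ioo (A k) 0, IsWeaklyDivFree (w k t) := fun k t ht =>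
    zoom_isWeaklyDivFree hν hsol hR hαeq hβeq (hcpos k) hδT ht
  have hmildW : ∀ k, ∀ s t : ℝ, A k < s → s < t → t < 0 → ∀ y,
      w k t y = UnboundedOperators.heatExtension (w k s) (t - s) y -
        oseenDuhamel 1 s (w k) (w k) t y := fun k s t hs hst ht y =>
    zoom_oseen hν hT hsol hLH hdec hR hαeq hβeq (hcpos k) hδT hs hst ht y
  set C₁ : ℝ := α * C / Real.sqrt β with hC₁
  have hIW : ∀ k, ∀ t ∈ Ioo (A k) 0, ∀ y, ‖w k t y‖ ≤ C₁ / Real.sqrt (-t) := fun k t ht y =>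
    zoom_norm_le hR hαeq hβeq hν (hcpos k) hδT hrate ht y
  -- ## (4) extraction of the `C¹_loc` limit `W ∈ 𝒦_{C₁}`
  obtain ⟨φ, hφ, W, hWclass, hpt, hptG, -, -⟩ :=
    exists_tendsto_of_typeI_seq_Ioo C₁ hAlim hcW hdivW hmildW hIW
  have hφt : Tendsto φ atTop atTop := hφ.tendsto_atTop
  have hcφ : Tendsto (fun j => c (φ j)) atTop (𝓝 0) := hclim.comp hφt
  have hAφ : Tendsto (fun j => A (φ j)) atTop atBot := hAlim.comp hφt
  -- ## (5) the scale-invariant energies of `W`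
  set B : ℝ := max (α ^ 2 * M₀ / R ^ 2) I₀.toReal with hB
  have hB0 : 0 ≤ B := le_max_of_le_right ENNReal.toReal_nonneg
  have henA : ∀ (x₁ : EuclideanSpace ℝ (Fin 3)) (t : ℝ), t < 0 → ∀ r : ℝ, 0 < r →
      ∀ᶠ j in atTop, r⁻¹ * ∫ y in ball x₁ r, ‖w (φ j) t y‖ ^ 2 ≤ B := by
    intro x₁ t ht r hr
    have e1 : ∀ᶠ j in atTop, c (φ j) * R * r < r₀ := by
      have h : Tendsto (fun j => c (φ j) * R * r) atTop (𝓝 (0 * R * r)) :=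
        (hcφ.mul_const R).mul_const r
      rw [zero_mul, zero_mul] at h
      exact h.eventually_lt_const hr₀
    have e2 : ∀ᶠ j in atTop, T₁ < T + c (φ j) ^ 2 * β * t := by
      have h : Tendsto (fun j => T + c (φ j) ^ 2 * β * t) atTop (𝓝 (T + 0 ^ 2 * β * t)) :=
        (((hcφ.pow 2).mul_const β).mul_const t).const_add T
      rw [zero_pow two_ne_zero, zero_mul, zero_mul, add_zero] at h
      exact h.eventually_const_lt hT₁
    filter_upwards [e1, e2] with j hj1 hj2
    have hpos : 0 < c (φ j) ^ 2 * β := by positivity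
    have hlt : T + c (φ j) ^ 2 * β * t < T := by nlinarith
    exact (zoom_scaledEnergy_le hR (hcpos (φ j)) hMor ⟨hj2, hlt⟩ x₁ hr hj1.le).trans (le_max_left _ _)
  have henE : ∀ (x₁ : EuclideanSpace ℝ (Fin 3)) (t₀ r : ℝ), t₀ < 0 → 0 < r →
      ∀ᶠ j in atTop,
        r⁻¹ * ∫ t in Ioo (t₀ - r ^ 2) t₀, ∫ y in ball x₁ r, ‖fderiv ℝ (w (φ j) t) y‖ ^ 2 ≤ B := by
    intro x₁ t₀ r ht₀ hr
    have e1 : ∀ᶠ j in atTop, A (φ j) < t₀ - r ^ 2 - 1 := hAφ.eventually (eventually_lt_atBot _)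
    have e2 : ∀ᶠ j in atTop, c (φ j) ^ 2 * (r ^ 2 - t₀) < 1 / 4 := by
      have h : Tendsto (fun j => c (φ j) ^ 2 * (r ^ 2 - t₀)) atTop (𝓝 (0 ^ 2 * (r ^ 2 - t₀))) :=
        (hcφ.pow 2).mul_const _
      rw [zero_pow two_ne_zero, zero_mul] at h
      exact h.eventually_lt_const (by norm_num)
    have e3 : ∀ᶠ j in atTop, c (φ j) * (‖x₁‖ + r) < 1 / 2 := by
      have h : Tendsto (fun j => c (φ j) * (‖x₁‖ + r)) atTop (𝓝 (0 * (‖x₁‖ + r))) :=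
        hcφ.mul_const _
      rw [zero_mul] at h
      exact h.eventually_lt_const (by norm_num)
    filter_upwards [e1, e2, e3] with j hj1 hj2 hj3
    exact (zoom_gradEnergy_le (x₀ := x₀) (πv := πv) hν hsol hR hαeq hβeq (hcpos (φ j)) hδT hI₀top ht₀ hr
      (by linarith) hj2.le hj3.le).trans (le_max_right _ _)
  have hen := energyBounds_of_tendsto_Ioo C₁ hB0 hAφ (w := fun j => w (φ j))
    (fun j => hcW (φ j)) (fun j => hdivW (φ j)) (fun j => hmildW (φ j)) (fun j => hIW (φ j))
    henA henE hWclass hpt hptG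
  -- ## (6) `W` is unbounded at the origin
  have hsingW : ∀ r > 0, ∀ M : ℝ, ∃ t ∈ Ioo (-(r ^ 2)) (0 : ℝ),
      ∃ x ∈ ball (0 : EuclideanSpace ℝ (Fin 3)) r, M < ‖W t x‖ :=
    zoomSeq_unbounded_at_origin (πv := πv) hsol hR hα hβ hβT hsing hball hGv hI₀top
      (fun j => hcpos (φ j)) (fun j => hc2 (φ j)) fun z hz =>
        hpt z.1 ((SuitableCompactness.mem_parabolicCylinder_zero.1 hz).1.2) z.2
  -- ## (7) one constant for the rate and the energies
  refine ⟨max C₁ B, W, ?_, ?_, hsingW⟩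
  · exact ⟨hWclass.1, hWclass.2.1, hWclass.2.2.1, fun t ht x =>
      (hWclass.norm_le ht x).trans
        (div_le_div_of_nonneg_right (le_max_left _ _) (Real.sqrt_nonneg _))⟩
  · intro x₁ t₀ r ht₀ hr
    obtain ⟨h1, h2⟩ := hen x₁ t₀ r ht₀ hr
    exact ⟨fun t ht1 ht2 => (h1 t ht1 ht2).trans (le_max_right _ _), h2.trans (le_max_right _ _)⟩

/-- **`SingularZoom` (item stmt-NavierStokesRegularity-10573, route `SqueezeCycle`) holds**: the
tree's reduction `singularZoom_of_zoomLimit` fed with the singular Type-I zoom limit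
`singularZoom_zoomLimit`. [cite: AlbrittonBarker2019, §3; LemarieRieusset2016, Thm 15.1 (C)] -/
theorem singularZoom_proof :
    Summit.NavierStokesRegularity.NavierStokesRegularity.Theses.SqueezeCycle.SingularZoom := by
  unfold Summit.NavierStokesRegularity.NavierStokesRegularity.Theses.SqueezeCycle.SingularZoom
  exact singularZoom_of_zoomLimit singularZoom_zoomLimit

/-- **`SingularZoom` of route `ClockStretchingLaw` (the same shared item
stmt-NavierStokesRegularity-10573, verbatim the same statement) holds.** [cite: AlbrittonBarker2019, §3] -/
theorem clockStretchingLaw_singularZoom_proof :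
    Summit.NavierStokesRegularity.NavierStokesRegularity.Theses.ClockStretchingLaw.SingularZoom := by
  unfold Summit.NavierStokesRegularity.NavierStokesRegularity.Theses.ClockStretchingLaw.SingularZoom
  exact singularZoom_of_zoomLimit singularZoom_zoomLimit

end Summit.NavierStokesRegularity.NavierStokesRegularity.Theorems

end
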